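import Literature.NumberTheory.Transcendental.KZHomotopyMoves
import Literature.NumberTheory.Transcendental.KZCubicalCalculus

/-!
# The cone substitution `(x₀, x₁) ↦ (x₀, x₀x₁)` from the square onto the ordered simplex

Support file for item `QuarterDiscFaceWeightTwo` (stmt-KontsevichZagierPeriods-9437, route
KontsevichZagierPeriods/OctahedralSymmetry). `cube_to_simplex`: a representation `R` on the closed
unit square `[0,1]²` whose integrand agrees there with `f`, and a representation `R'` on the open
ordered simplex `{1 > t₀ > t₁ > 0}` whose integrand agrees there with `g`, are KZ-equivalent as soon
as `f(x) = g(x₀, x₀x₁) · x₀` for `0 < x₀ < 1`, `0 ≤ x₁ ≤ 1` (and `g` is `ℚ`-semialgebraic on the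
closed-fibre simplex `{0 < t₀ < 1, 0 ≤ t₁ ≤ t₀}`): the normalisation `t₁ = t₀ x₁` of the inner
variable of an iterated integral. Chain of moves: restriction of `R` to `(0,1) × [0,1]` (two null
segments, rule (1a)), the affine substitution along the last coordinate
(`KZ.of_sub_of_mem_relations_of_affine`, rule (2), Jacobian `x₀`), opening the fibres
(`KZ.of_sub_of_restrict_openBand_mem_relations`) and congruence of integrands (rule (1b)).

References: M. Kontsevich, D. Zagier, *Periods* (2001), §1.2 rules (1), (2).
Design: theorems only, no definitions.
-/

noncomputable section

open Set MeasureTheory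
open Literature.NumberTheory.Transcendental Literature.NumberTheory.Transcendental.KZ
open Literature.ModelTheory.ExponentialFields (IsSemialgebraic)

namespace Summit.KontsevichZagierPeriods.OctahedralSymmetry.QuarterDiscFace

/-- **The cone substitution is a chain of Kontsevich–Zagier moves.** Let `R` be a representation on
the closed square `[0,1]²` with integrand `f` there, `R'` one on the open ordered simplex
`{1 > t₀ > t₁ > 0}` with integrand `g` there, `g` `ℚ`-semialgebraic on `{0 < t₀ < 1, 0 ≤ t₁ ≤ t₀}`,
and `f(x) = g(x₀, x₀ x₁) · x₀` for `0 < x₀ < 1`, `0 ≤ x₁ ≤ 1`. Then `[R] − [R'] ∈ KZ.relations`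
(substitution `t₁ = x₀ x₁`, Jacobian `x₀ > 0`, plus null boundary pieces).
[cite: KontsevichZagier2001, §1.2 rule (2)] -/
theorem cube_to_simplex {f g : (Fin 2 → ℝ) → ℝ} (R R' : IntegralRep 2)
    (hR : R.domain = cube 2) (hRi : EqOn R.integrand f (cube 2))
    (hR' : R'.domain = {t | 1 > t 0 ∧ t 0 > t 1 ∧ t 1 > 0}) (hR'i : EqOn R'.integrand g R'.domain)
    (hg : IsSemialgebraicFunOn ℚ
      (KZlog.band {y : Fin 1 → ℝ | 0 < y 0 ∧ y 0 < 1} (fun _ => 0) (fun y => y 0)) g)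
    (hfg : ∀ z : Fin 2 → ℝ, 0 < z 0 → z 0 < 1 → 0 ≤ z 1 → z 1 ≤ 1 →
      f z = g ![z 0, z 0 * z 1] * z 0) :
    of R - of R' ∈ relations := by
  -- coordinate hyperplanes are null; everything is integrable on a null set
  have hplane : ∀ (i : Fin 2) (c : ℝ), volume {z : Fin 2 → ℝ | z i = c} = 0 := fun i c => by
    rw [volume_pi]
    exact Measure.pi_hyperplane _ _ _
  have hnullint : ∀ {N : Set (Fin 2 → ℝ)}, volume N = 0 → IntegrableOn g N := fun hN => by
    rw [IntegrableOn, Measure.restrict_eq_zero.2 hN]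
    exact integrable_zero_measure
  set G : Set (Fin 1 → ℝ) := {y | 0 < y 0 ∧ y 0 < 1} with hG
  have hGs : IsSemialgebraic ℚ G := isSemialgebraic_unitInterval_fin_one
  have hGo : IsOpen G :=
    (isOpen_lt continuous_const (continuous_apply 0)).inter
      (isOpen_lt (continuous_apply 0) continuous_const)
  have h0s : IsSemialgebraicFunOn ℚ G (fun _ => (0 : ℝ)) := by
    simpa using isSemialgebraicFunOn_ratCast hGs 0
  have h1s : IsSemialgebraicFunOn ℚ G (fun _ => (1 : ℝ)) := by
    simpa using isSemialgebraicFunOn_ratCast hGs 1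
  have hbs : IsSemialgebraicFunOn ℚ G (fun y => y 0) := isSemialgebraicFunOn_apply hGs 0
  -- the two bands over `G`
  set B₁ : Set (Fin 2 → ℝ) := KZlog.band G (fun _ => (0 : ℝ)) (fun _ => 1) with hB₁
  set B₂ : Set (Fin 2 → ℝ) := KZlog.band G (fun _ => (0 : ℝ)) (fun y => y 0) with hB₂
  have hB₁s : IsSemialgebraic ℚ B₁ := KZlog.isSemialgebraic_band h0s h1s
  have hB₂s : IsSemialgebraic ℚ B₂ := KZlog.isSemialgebraic_band h0s hbs
  have memB₁ : ∀ z : Fin 2 → ℝ, z ∈ B₁ ↔ (0 < z 0 ∧ z 0 < 1) ∧ 0 ≤ z 1 ∧ z 1 ≤ 1 := fun z => Iff.rfl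
  have memB₂ : ∀ z : Fin 2 → ℝ, z ∈ B₂ ↔ (0 < z 0 ∧ z 0 < 1) ∧ 0 ≤ z 1 ∧ z 1 ≤ z 0 := fun z => Iff.rfl
  have hB₁sub : B₁ ⊆ R.domain := by
    rw [hR]
    intro z hz
    rw [memB₁] at hz
    rw [mem_cube, Fin.forall_fin_two]
    exact ⟨⟨hz.1.1.le, hz.1.2.le⟩, hz.2⟩
  -- (1) restrict `R` to `(0,1) × [0,1]`
  have hnull : volume (R.domain \ B₁) = 0 := by
    have hcov : R.domain \ B₁ ⊆ {z | z 0 = 0} ∪ {z | z 0 = 1} := by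
      rw [hR]
      rintro z ⟨hz, hzB⟩
      rw [mem_cube, Fin.forall_fin_two] at hz
      rw [memB₁] at hzB
      simp only [mem_union, mem_setOf_eq]
      by_contra h
      push Not at h
      exact hzB ⟨⟨lt_of_le_of_ne hz.1.1 (Ne.symm h.1), lt_of_le_of_ne hz.1.2 h.2⟩, hz.2⟩
    exact measure_mono_null hcov
      (measure_union_null (hplane 0 0) (hplane 0 1))
  have h1 := R.of_sub_of_restrict_mem_relations hB₁s hB₁sub hnull
  -- (2) the closed-fibre simplex representation and the affine substitution
  have hΔm : MeasurableSet R'.domain := IntegralRep.measurableSet_domain_holds R'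
  have hgi : IntegrableOn g B₂ := by
    have hΔ : IntegrableOn g R'.domain := R'.integrableOn.congr_fun hR'i hΔm
    have hN : volume (B₂ \ R'.domain) = 0 := by
      have hcov : B₂ \ R'.domain ⊆ {z | z 1 = 0} ∪
          {z : Fin 2 → ℝ | Fin.init z ∈ G ∧ z (Fin.last 1) = (Fin.init z) 0} := by
        rintro z ⟨hz, hzΔ⟩
        rw [memB₂] at hz
        rw [hR'] at hzΔ
        simp only [mem_setOf_eq, gt_iff_lt, not_and, not_lt] at hzΔ
        simp only [mem_union, mem_setOf_eq]
        by_cases h0 : z 1 = 0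
        · exact Or.inl h0
        · right
          refine ⟨hz.1, ?_⟩
          have h3 := hzΔ hz.1.2
          rcases hz.2.2.lt_or_eq with hlt | heq
          · exact absurd (h3 hlt) (not_le.2 (lt_of_le_of_ne hz.2.1 (Ne.symm h0)))
          · exact heq
      exact measure_mono_null hcov
        (measure_union_null (hplane 1 0) (volume_graph_eq_zero hbs))
    have hun : IntegrableOn g (R'.domain ∪ (B₂ \ R'.domain)) := hΔ.union (hnullint hN)
    exact hun.mono_set fun z hz => by
      by_cases h : z ∈ R'.domain
      · exact Or.inl h
      · exact Or.inr ⟨hz, h⟩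
  let rg : IntegralRep 2 := ⟨B₂, g, hB₂s, hg, hgi⟩
  have h2 : of (R.restrict B₁ hB₁s hB₁sub) - of rg ∈ relations := by
    refine of_sub_of_mem_relations_of_affine (G := G) hGo (α := fun _ => 0) (β := fun y => y 0)
      (a := fun _ => 0) (b := fun _ => 1) (a' := fun _ => 0) (b' := fun y => y 0) h0s hbs
      (differentiableOn_const _) (differentiable_apply 0).differentiableOn (fun y hy => hy.1)
      _ rg rfl rfl (fun y _ => by simp) (fun y _ => by simp) ?_
    intro z hz
    change z ∈ B₁ at hz
    rw [memB₁] at hz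
    have hzc : z ∈ cube 2 := by
      rw [mem_cube, Fin.forall_fin_two]
      exact ⟨⟨hz.1.1.le, hz.1.2.le⟩, hz.2⟩
    change R.integrand z = g _ * (Fin.init z) 0
    have hsnoc : ∀ c : ℝ, (Fin.snoc (Fin.init z) c : Fin 2 → ℝ) = ![z 0, c] := fun c => by
      ext i
      fin_cases i
      · rfl
      · rfl
    rw [hRi hzc, hfg z hz.1.1 hz.1.2 hz.2.1 hz.2.2, hsnoc]
    simp [Fin.init]
  -- (3) open the fibres of the simplex band
  obtain ⟨ro, hrod, hroi, h3⟩ :=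
    of_sub_of_restrict_openBand_mem_relations (B := G) (a := fun _ => (0 : ℝ)) (b := fun y => y 0)
      h0s hbs rg rfl
  -- (4) congruence with `R'`
  have h4 : of ro - of R' ∈ relations := by
    have hdom : R'.domain = ro.domain := by
      rw [hR', hrod]
      ext z
      change (1 > z 0 ∧ z 0 > z 1 ∧ z 1 > 0) ↔ ((0 < z 0 ∧ z 0 < 1) ∧ 0 < z 1 ∧ z 1 < z 0)
      constructor
      · rintro ⟨h1, h2, h3⟩; exact ⟨⟨by linarith, h1⟩, h3, h2⟩
      · rintro ⟨⟨h1, h2⟩, h3, h4⟩; exact ⟨h2, h4, h3⟩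
    refine of_sub_of_mem_relations_of_eqOn hdom fun z hz => ?_
    rw [hroi]
    change g z = R'.integrand z
    rw [← hdom] at hz
    exact (hR'i hz).symm
  have : of R - of R' = (of R - of (R.restrict B₁ hB₁s hB₁sub)) +
      (of (R.restrict B₁ hB₁s hB₁sub) - of rg) + (of rg - of ro) + (of ro - of R') := by abel
  rw [this]
  exact relations.add_mem (relations.add_mem (relations.add_mem h1 h2) h3) h4

end Summit.KontsevichZagierPeriods.OctahedralSymmetry.QuarterDiscFace

end
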